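import Mathlib.Analysis.SpecialFunctions.Pow.Real
import Mathlib.Algebra.Order.Chebyshev
import HarnessLib

/-!
# Real-analysis helpers for the word-uniform `∛320` surface rung (crux `StackingLiminf`,
# stmt-Ventures-19145, route StickyWulffConstant)

Cell `crystal3d-full`, venture `Summits/Ventures/Crystal3D`.  Pure real inequalities used by
`StickyWulffConstantStackingLiminfRefinedBound.lean`; no packings here.

* `rpow_le_div_sqrt_add_mul` — the AM-GM endgame `(27ω²β/4)^{1/3} N^{2/3} ≤ ωN/√M + βM`.
* `interface_calibration` — the per-interface CALIBRATION inequality: if an interface cost `β`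
  between layers of sizes `p, q ∈ [0, M]` satisfies `β ≥ (3/2)|p − q|` and
  `β ≥ (1/2)|p − q| + c√(max p q)`, then for any "dual" triple `θ, Ψ, Ψ₂`
  (`0 ≤ θ ≤ 1`, `Ψ(y) − Ψ(x) ≥ θ(x)(y − x)`, `Ψ₂(x) ≤ cθ(x)√x`, `G := 3x/2 − Ψ − Ψ₂/2` monotone)
  `β ≥ Ψ₂(p)/2 + Ψ₂(q)/2 + |G(p) − G(q)|` — so interface costs telescope.
* the concrete dual functions `θ(x) = (x−a)₊/(M−a)`, `Ψ(x) = (x−a)₊²/(2(M−a))`,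
  `Ψ₂(x) = √a·θ(x)` with `a = 16M/25`: their properties, the value
  `2G(M) = (66/25)M − (4/5)√M`, and the per-layer inequality
  `√(12n − 3) + Ψ₂(n) ≥ (17/4)·n/√M` (`1 ≤ n ≤ M`, `M ≥ 31`).
* `two_mul_le_sum_abs_sub` — total variation of a sequence through its maximum.

WHAT THIS IS NOT: any statement about sphere packings.
-/

noncomputable section

namespace Summit.Ventures.Crystal3D.Theorems

open Finset

/-- AM-GM endgame: for `N ≥ 0`, `M > 0`, `ω, β ≥ 0`:
`(27ω²β/4)^{1/3}·N^{2/3} ≤ ωN/√M + βM` (from `4(a+b)³ − 27a²b = (a−2b)²(4a+b) ≥ 0` with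
`a = ωN/√M`, `b = βM`, `a²b = ω²βN²`). -/
theorem rpow_le_div_sqrt_add_mul {N M ω β : ℝ} (hN : 0 ≤ N) (hM : 0 < M) (hω : 0 ≤ ω)
    (hβ : 0 ≤ β) :
    (27 * ω ^ 2 * β / 4) ^ ((1 : ℝ) / 3) * N ^ ((2 : ℝ) / 3) ≤ ω * N / Real.sqrt M + β * M := by
  have hsM : 0 < Real.sqrt M := Real.sqrt_pos.2 hM
  set a : ℝ := ω * N / Real.sqrt M with ha
  set b : ℝ := β * M with hb
  have ha0 : 0 ≤ a := by positivity
  have hb0 : 0 ≤ b := by positivity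
  have ha2 : a ^ 2 * b = ω ^ 2 * β * N ^ 2 := by
    rw [ha, hb, div_pow, mul_pow, Real.sq_sqrt hM.le]
    field_simp
  have hcube : 27 * ω ^ 2 * β / 4 * N ^ 2 ≤ (a + b) ^ 3 := by
    have key : 4 * (a + b) ^ 3 = 27 * (a ^ 2 * b) + (a - 2 * b) ^ 2 * (4 * a + b) := by ring
    have hsos : 0 ≤ (a - 2 * b) ^ 2 * (4 * a + b) := by positivity
    rw [ha2] at key
    nlinarith
  have hab : 0 ≤ a + b := by positivity
  have h3 : ((a + b) ^ 3) ^ ((1 : ℝ) / 3) = a + b := by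
    rw [show ((1 : ℝ) / 3) = ((3 : ℕ) : ℝ)⁻¹ by norm_num]
    exact Real.pow_rpow_inv_natCast hab (by norm_num)
  have hK : 0 ≤ 27 * ω ^ 2 * β / 4 := by positivity
  have hroot : (27 * ω ^ 2 * β / 4 * N ^ 2) ^ ((1 : ℝ) / 3) ≤ a + b := by
    rw [← h3]
    exact Real.rpow_le_rpow (by positivity) hcube (by norm_num)
  have hsplit : (27 * ω ^ 2 * β / 4 * N ^ 2) ^ ((1 : ℝ) / 3) =
      (27 * ω ^ 2 * β / 4) ^ ((1 : ℝ) / 3) * N ^ ((2 : ℝ) / 3) := by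
    rw [Real.mul_rpow hK (by positivity)]
    congr 1
    rw [show ((2 : ℝ) / 3) = 2 * ((1 : ℝ) / 3) by norm_num, Real.rpow_mul hN]
    congr 1
    exact_mod_cast (Real.rpow_natCast N 2).symm
  have : a + b = ω * N / Real.sqrt M + β * M := by rw [ha, hb]
  linarith [hroot, hsplit]

/-- **Per-interface calibration.** See the module docstring: under the two interface bounds
`(3/2)|p−q| ≤ β`, `(1/2)|p−q| + c√(max p q) ≤ β` and a dual triple `(θ, Ψ, Ψ₂)` on `[0, M]`,
`Ψ₂(p)/2 + Ψ₂(q)/2 + |G(p) − G(q)| ≤ β` with `G(x) = 3x/2 − Ψ(x) − Ψ₂(x)/2`. -/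
theorem interface_calibration {c M p q β : ℝ} {θ Ψ Ψ₂ : ℝ → ℝ}
    (hc : 0 ≤ c) (hp : 0 ≤ p) (hq : 0 ≤ q) (hpM : p ≤ M) (hqM : q ≤ M)
    (hθ0 : ∀ x, 0 ≤ x → 0 ≤ θ x) (hθ1 : ∀ x, x ≤ M → θ x ≤ 1)
    (hΨ : ∀ x y, 0 ≤ x → x ≤ y → θ x * (y - x) ≤ Ψ y - Ψ x)
    (hΨ₂ : ∀ x, 0 ≤ x → Ψ₂ x ≤ c * θ x * Real.sqrt x)
    (hG : ∀ x y, 0 ≤ x → x ≤ y → y ≤ M →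
      3 / 2 * x - Ψ x - Ψ₂ x / 2 ≤ 3 / 2 * y - Ψ y - Ψ₂ y / 2)
    (hβ1 : 3 / 2 * |p - q| ≤ β) (hβ2 : 1 / 2 * |p - q| + c * Real.sqrt (max p q) ≤ β) :
    Ψ₂ p / 2 + Ψ₂ q / 2 +
      |(3 / 2 * p - Ψ p - Ψ₂ p / 2) - (3 / 2 * q - Ψ q - Ψ₂ q / 2)| ≤ β := by
  -- the ordered case `q ≤ p`
  have key : ∀ p q : ℝ, 0 ≤ q → q ≤ p → p ≤ M → 3 / 2 * (p - q) ≤ β →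
      1 / 2 * (p - q) + c * Real.sqrt p ≤ β →
      Ψ₂ p / 2 + Ψ₂ q / 2 +
        ((3 / 2 * p - Ψ p - Ψ₂ p / 2) - (3 / 2 * q - Ψ q - Ψ₂ q / 2)) ≤ β := by
    intro p q hq hqp hpM h1 h2
    have hθq0 := hθ0 q hq
    have hθq1 := hθ1 q (hqp.trans hpM)
    have hψ := hΨ q p hq hqp
    have hψ₂ := hΨ₂ q hq
    have hsq : 0 ≤ Real.sqrt q := Real.sqrt_nonneg q
    have hsqp : Real.sqrt q ≤ Real.sqrt p := Real.sqrt_le_sqrt hqp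
    rcases le_or_gt (c * Real.sqrt q) (p - q) with hcase | hcase
    · -- steep: `Ψ p − Ψ q ≥ θ q (p − q) ≥ θ q · c√q ≥ Ψ₂ q`
      have : θ q * (c * Real.sqrt q) ≤ θ q * (p - q) := mul_le_mul_of_nonneg_left hcase hθq0
      nlinarith
    · -- shallow: use `θ q ≤ 1`
      have : θ q * (c * Real.sqrt q - (p - q)) ≤ 1 * (c * Real.sqrt q - (p - q)) :=
        mul_le_mul_of_nonneg_right hθq1 (by linarith)
      nlinarith [mul_nonneg hc (sub_nonneg.2 hsqp)]
  rcases le_total q p with hqp | hpq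
  · have hG' := hG q p hq hqp hpM
    have e1 : |p - q| = p - q := abs_of_nonneg (by linarith)
    have e2 : |(3 / 2 * p - Ψ p - Ψ₂ p / 2) - (3 / 2 * q - Ψ q - Ψ₂ q / 2)| =
        (3 / 2 * p - Ψ p - Ψ₂ p / 2) - (3 / 2 * q - Ψ q - Ψ₂ q / 2) :=
      abs_of_nonneg (by linarith)
    rw [e1] at hβ1 hβ2
    rw [max_eq_left hqp] at hβ2
    rw [e2]
    exact key p q hq hqp hpM (by linarith) hβ2
  · have hG' := hG p q hp hpq hqM
    have e1 : |p - q| = q - p := by rw [abs_sub_comm]; exact abs_of_nonneg (by linarith)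
    have e2 : |(3 / 2 * p - Ψ p - Ψ₂ p / 2) - (3 / 2 * q - Ψ q - Ψ₂ q / 2)| =
        (3 / 2 * q - Ψ q - Ψ₂ q / 2) - (3 / 2 * p - Ψ p - Ψ₂ p / 2) := by
      rw [abs_sub_comm]; exact abs_of_nonneg (by linarith)
    rw [e1] at hβ1 hβ2
    rw [max_eq_right hpq] at hβ2
    rw [e2]
    have := key q p hp hpq hqM (by linarith) hβ2
    linarith

/-! ### The concrete dual functions `θ(x) = (x−a)₊/(M−a)`, `Ψ(x) = (x−a)₊²/(2(M−a))`,
`Ψ₂(x) = √a·θ(x)` -/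

/-- `θ ≥ 0`. -/
theorem theta_nonneg {a M : ℝ} (haM : a < M) (x : ℝ) : 0 ≤ max (x - a) 0 / (M - a) :=
  div_nonneg (le_max_right _ _) (by linarith)

/-- `θ ≤ 1` on `(-∞, M]`. -/
theorem theta_le_one {a M x : ℝ} (haM : a < M) (hx : x ≤ M) : max (x - a) 0 / (M - a) ≤ 1 := by
  rw [div_le_one (by linarith)]
  exact max_le (by linarith) (by linarith)

/-- Lower convexity bound: `θ(x)(y − x) ≤ Ψ(y) − Ψ(x)` for `x ≤ y`. -/
theorem theta_mul_le_psi_sub {a M x y : ℝ} (haM : a < M) (hxy : x ≤ y) :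
    max (x - a) 0 / (M - a) * (y - x) ≤
      (max (y - a) 0) ^ 2 / (2 * (M - a)) - (max (x - a) 0) ^ 2 / (2 * (M - a)) := by
  have hMa : 0 < M - a := by linarith
  rw [div_mul_eq_mul_div, ← sub_div, div_le_div_iff₀ hMa (by linarith)]
  rcases le_or_gt a x with hax | hax
  · rw [max_eq_left (by linarith), max_eq_left (by linarith)]
    have key : ((y - a) ^ 2 - (x - a) ^ 2) * (M - a) - (x - a) * (y - x) * (2 * (M - a)) =
        (y - x) ^ 2 * (M - a) := by ring
    nlinarith [mul_nonneg (sq_nonneg (y - x)) hMa.le]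
  · rw [max_eq_right (by linarith)]
    nlinarith [mul_nonneg (sq_nonneg (max (y - a) 0)) hMa.le]

/-- Upper convexity bound: `Ψ(y) − Ψ(x) ≤ θ(y)(y − x)` for `x ≤ y`. -/
theorem psi_sub_le_theta_mul {a M x y : ℝ} (haM : a < M) (hxy : x ≤ y) :
    (max (y - a) 0) ^ 2 / (2 * (M - a)) - (max (x - a) 0) ^ 2 / (2 * (M - a)) ≤
      max (y - a) 0 / (M - a) * (y - x) := by
  have hMa : 0 < M - a := by linarith
  rw [div_mul_eq_mul_div, ← sub_div, div_le_div_iff₀ (by linarith) hMa]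
  rcases le_or_gt a y with hay | hay
  · rw [max_eq_left (by linarith)]
    rcases le_or_gt a x with hax | hax
    · rw [max_eq_left (by linarith)]
      have key : (y - a) * (y - x) * (2 * (M - a)) - ((y - a) ^ 2 - (x - a) ^ 2) * (M - a) =
          (y - x) ^ 2 * (M - a) := by ring
      nlinarith [mul_nonneg (sq_nonneg (y - x)) hMa.le]
    · rw [max_eq_right (by linarith)]
      have h1 : (y - a) ^ 2 ≤ (y - a) * (y - x) := by nlinarith
      nlinarith [mul_nonneg (mul_nonneg (sub_nonneg.2 hay) (sub_nonneg.2 hxy)) hMa.le]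
  · rw [max_eq_right (by linarith), max_eq_right (by linarith)]
    nlinarith

/-- `Ψ₂(x) = √a·θ(x) ≤ θ(x)·√x` (both vanish below `a`, and `√a ≤ √x` above). -/
theorem sqrt_mul_theta_le {a M x : ℝ} (haM : a < M) :
    Real.sqrt a * (max (x - a) 0 / (M - a)) ≤ 1 * (max (x - a) 0 / (M - a)) * Real.sqrt x := by
  rcases le_or_gt a x with hax | hax
  · have := Real.sqrt_le_sqrt hax
    have h0 := theta_nonneg haM x
    nlinarith
  · rw [max_eq_right (by linarith)]; simp

/-- Monotonicity of `G(x) = 3x/2 − Ψ(x) − Ψ₂(x)/2` on `(-∞, M]` when `√a ≤ M − a`. -/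
theorem G_mono {a M x y : ℝ} (haM : a < M) (ha : Real.sqrt a ≤ M - a) (hxy : x ≤ y)
    (hyM : y ≤ M) :
    3 / 2 * x - (max (x - a) 0) ^ 2 / (2 * (M - a)) -
        Real.sqrt a * (max (x - a) 0 / (M - a)) / 2 ≤
      3 / 2 * y - (max (y - a) 0) ^ 2 / (2 * (M - a)) -
        Real.sqrt a * (max (y - a) 0 / (M - a)) / 2 := by
  have hMa : 0 < M - a := by linarith
  have h1 := psi_sub_le_theta_mul (a := a) (M := M) haM hxy
  have h2 : max (y - a) 0 / (M - a) ≤ 1 := theta_le_one haM hyM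
  have hmono : max (x - a) 0 / (M - a) ≤ max (y - a) 0 / (M - a) :=
    (div_le_div_iff_of_pos_right hMa).2 (max_le_max (by linarith) le_rfl)
  -- `θ` is `1/(M−a)`-Lipschitz
  have h3 : max (y - a) 0 / (M - a) - max (x - a) 0 / (M - a) ≤ (y - x) / (M - a) := by
    rw [← sub_div, div_le_div_iff_of_pos_right hMa]
    rcases le_or_gt a x with hax | hax
    · rw [max_eq_left (by linarith : (0 : ℝ) ≤ x - a),
        max_eq_left (by linarith : (0 : ℝ) ≤ y - a)]
      linarith
    · rw [max_eq_right (by linarith : x - a ≤ 0), sub_zero]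
      exact max_le (by linarith) (by linarith)
  have h4 : Real.sqrt a * (max (y - a) 0 / (M - a) - max (x - a) 0 / (M - a)) ≤
      (M - a) * ((y - x) / (M - a)) :=
    mul_le_mul ha h3 (sub_nonneg.2 hmono) hMa.le
  rw [mul_div_cancel₀ _ hMa.ne', mul_sub] at h4
  have h5 : (max (y - a) 0) ^ 2 / (2 * (M - a)) - (max (x - a) 0) ^ 2 / (2 * (M - a)) ≤
      y - x := h1.trans (mul_le_of_le_one_left (sub_nonneg.2 hxy) h2)
  linarith

/-- `G(0) = 0` (for `a ≥ 0`). -/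
theorem G_zero {a M : ℝ} (ha : 0 ≤ a) :
    3 / 2 * (0 : ℝ) - (max (0 - a) 0) ^ 2 / (2 * (M - a)) -
      Real.sqrt a * (max (0 - a) 0 / (M - a)) / 2 = 0 := by
  rw [max_eq_right (by linarith)]; simp

/-- `G(M) = 3M/2 − (M − a)/2 − √a/2`. -/
theorem G_top {a M : ℝ} (haM : a < M) :
    3 / 2 * M - (max (M - a) 0) ^ 2 / (2 * (M - a)) -
      Real.sqrt a * (max (M - a) 0 / (M - a)) / 2 = 3 / 2 * M - (M - a) / 2 - Real.sqrt a / 2 := by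
  have hMa : 0 < M - a := by linarith
  have e : (M - a) ^ 2 / (2 * (M - a)) = (M - a) / 2 := by
    rw [div_eq_iff (ne_of_gt (by linarith))]; ring
  rw [max_eq_left hMa.le, div_self hMa.ne', e, mul_one]

/-- **The per-layer inequality** for `a = 16M/25`, `M ≥ 31`, `1 ≤ n ≤ M`:
`(17/4)·n/√M ≤ √(12n − 3) + Ψ₂(n)` with `Ψ₂(n) = √a·(n − a)₊/(M − a)`.  Both sides' squares are
compared; the quadratic polynomial inequalities are checked at the endpoints `n ∈ {1, a, M}` and
interpolated by concavity (chord identities). -/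
theorem omega_mul_div_sqrt_le {M n : ℝ} (hM : 31 ≤ M) (hn1 : 1 ≤ n) (hnM : n ≤ M) :
    17 / 4 * n / Real.sqrt M ≤ Real.sqrt (12 * n - 3) +
      Real.sqrt (16 * M / 25) * (max (n - 16 * M / 25) 0 / (M - 16 * M / 25)) := by
  have hM0 : 0 < M := by linarith
  set s := Real.sqrt M with hs
  have hs0 : 0 < s := Real.sqrt_pos.2 hM0
  have hs2 : s ^ 2 = M := Real.sq_sqrt hM0.le
  have hsa : Real.sqrt (16 * M / 25) = 4 / 5 * s := by
    rw [show 16 * M / 25 = (4 / 5 * s) ^ 2 by rw [mul_pow, hs2]; ring]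
    exact Real.sqrt_sq (by positivity)
  rw [hsa]
  set a := 16 * M / 25 with ha
  have hsq0 : 0 ≤ Real.sqrt (12 * n - 3) := Real.sqrt_nonneg _
  have hsq2 : Real.sqrt (12 * n - 3) ^ 2 = 12 * n - 3 := Real.sq_sqrt (by linarith)
  rcases le_or_gt n a with hna | hna
  · -- below `a`: `Ψ₂ = 0`, need `(17n/4)² ≤ (12n − 3)·M`
    rw [max_eq_right (by linarith), zero_div, mul_zero, add_zero, div_le_iff₀ hs0]
    have h1 : 0 ≤ 144 * M - 289 := by linarith
    have h2 : 0 ≤ 16 * M * (12 * a - 3) - 289 * a ^ 2 := by rw [ha]; nlinarith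
    have h3 : 0 ≤ (n - 1) * (a - n) := mul_nonneg (by linarith) (by linarith)
    have h4 : 0 < a - 1 := by rw [ha]; linarith
    have key : (a - 1) * (16 * M * (12 * n - 3) - 289 * n ^ 2) =
        (a - n) * (144 * M - 289) + (n - 1) * (16 * M * (12 * a - 3) - 289 * a ^ 2) +
          289 * ((n - 1) * (a - n)) * (a - 1) := by ring
    have h5 : 0 ≤ (a - 1) * (16 * M * (12 * n - 3) - 289 * n ^ 2) := by
      rw [key]
      exact add_nonneg (add_nonneg (mul_nonneg (by linarith) h1) (mul_nonneg (by linarith) h2))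
        (mul_nonneg (mul_nonneg (by norm_num) h3) h4.le)
    have h6 : 0 ≤ 16 * M * (12 * n - 3) - 289 * n ^ 2 := by
      by_contra h
      have := mul_neg_of_pos_of_neg h4 (lt_of_not_ge h)
      linarith
    have hsq : (17 / 4 * n) ^ 2 ≤ (Real.sqrt (12 * n - 3) * s) ^ 2 := by
      have e2 : (Real.sqrt (12 * n - 3) * s) ^ 2 = (12 * n - 3) * M := by
        rw [mul_pow, hsq2, hs2]
      rw [e2]; nlinarith
    exact (pow_le_pow_iff_left₀ (by positivity) (by positivity) two_ne_zero).1 hsq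
  · -- above `a`: `Ψ₂(n) = 20(n − a)/(9s)`
    rw [max_eq_left (by linarith)]
    have e : 4 / 5 * s * ((n - a) / (M - a)) = 20 * (n - a) / 9 / s := by
      rw [ha, ← hs2]; field_simp; ring
    rw [e, ← sub_le_iff_le_add, ← sub_div, div_le_iff₀ hs0]
    have hgM : 0 ≤ 39 * M ^ 2 / 400 - 3 * M := by nlinarith
    have hga : 0 ≤ 176 * M ^ 2 / 625 - 3 * M := by nlinarith
    have h3 : 0 ≤ (n - a) * (M - n) := mul_nonneg (by linarith) (by linarith)
    have h4 : 0 < M - a := by rw [ha]; linarith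
    have key : (M - a) * (M * (12 * n - 3) - (17 / 4 * n - 20 * (n - a) / 9) ^ 2) =
        (M - n) * (176 * M ^ 2 / 625 - 3 * M) + (n - a) * (39 * M ^ 2 / 400 - 3 * M) +
          (73 / 36) ^ 2 * ((n - a) * (M - n)) * (M - a) := by rw [ha]; ring
    have h5 : 0 ≤ (M - a) * (M * (12 * n - 3) - (17 / 4 * n - 20 * (n - a) / 9) ^ 2) := by
      rw [key]
      exact add_nonneg (add_nonneg (mul_nonneg (by linarith) hga) (mul_nonneg (by linarith) hgM))
        (mul_nonneg (mul_nonneg (by norm_num) h3) h4.le)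
    have h6 : 0 ≤ M * (12 * n - 3) - (17 / 4 * n - 20 * (n - a) / 9) ^ 2 := by
      by_contra h
      have := mul_neg_of_pos_of_neg h4 (lt_of_not_ge h)
      linarith
    have hl : 0 ≤ 17 / 4 * n - 20 * (n - a) / 9 := by rw [ha]; nlinarith
    have hsq : (17 / 4 * n - 20 * (n - a) / 9) ^ 2 ≤ (Real.sqrt (12 * n - 3) * s) ^ 2 := by
      have e2 : (Real.sqrt (12 * n - 3) * s) ^ 2 = (12 * n - 3) * M := by
        rw [mul_pow, hsq2, hs2]
      rw [e2]; nlinarith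
    exact (pow_le_pow_iff_left₀ hl (by positivity) two_ne_zero).1 hsq

/-- For `a = 16M/25` and `M ≥ 5`: `√a ≤ M − a` (the monotonicity condition of `G`). -/
theorem sqrt_a_le {M : ℝ} (hM : 5 ≤ M) : Real.sqrt (16 * M / 25) ≤ M - 16 * M / 25 := by
  have hM0 : 0 < M := by linarith
  have hsa : Real.sqrt (16 * M / 25) = 4 / 5 * Real.sqrt M := by
    rw [show 16 * M / 25 = (4 / 5 * Real.sqrt M) ^ 2 by
      rw [mul_pow, Real.sq_sqrt hM0.le]; ring]
    exact Real.sqrt_sq (by positivity)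
  rw [hsa]
  -- `(4/5)√M ≤ 9M/25` iff `√M ≥ 20/9`
  have h1 : (20 / 9 : ℝ) ≤ Real.sqrt M := by
    have := Real.sqrt_le_sqrt (show ((20 : ℝ) / 9) ^ 2 ≤ M by nlinarith)
    rwa [Real.sqrt_sq (by norm_num)] at this
  have h2 : Real.sqrt M * Real.sqrt M = M := Real.mul_self_sqrt hM0.le
  nlinarith

/-- `2·G(M) = (66/25)M − (4/5)√M` for `a = 16M/25`. -/
theorem two_mul_G_top {M : ℝ} (hM : 0 < M) :
    2 * (3 / 2 * M - (M - 16 * M / 25) / 2 - Real.sqrt (16 * M / 25) / 2) =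
      66 / 25 * M - 4 / 5 * Real.sqrt M := by
  have hsa : Real.sqrt (16 * M / 25) = 4 / 5 * Real.sqrt M := by
    rw [show 16 * M / 25 = (4 / 5 * Real.sqrt M) ^ 2 by
      rw [mul_pow, Real.sq_sqrt hM.le]; ring]
    exact Real.sqrt_sq (by positivity)
  rw [hsa]; ring

/-- Total variation through the maximum: if `g 0 = g L = 0` then
`2·g(j₀) ≤ ∑_{j<L} |g(j+1) − g(j)|` for every `j₀ ≤ L`. -/
theorem two_mul_le_sum_abs_sub (g : ℕ → ℝ) {L j₀ : ℕ} (hj : j₀ ≤ L) (h0 : g 0 = 0)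
    (hL : g L = 0) : 2 * g j₀ ≤ ∑ j ∈ Finset.range L, |g (j + 1) - g j| := by
  rw [← Finset.sum_range_add_sum_Ico _ hj]
  have h1 : g j₀ ≤ ∑ j ∈ Finset.range j₀, |g (j + 1) - g j| := by
    have := Finset.sum_range_sub g j₀
    rw [h0, sub_zero] at this
    rw [← this]
    exact Finset.sum_le_sum fun i _ => le_abs_self _
  have h2 : g j₀ ≤ ∑ j ∈ Finset.Ico j₀ L, |g (j + 1) - g j| := by
    rw [Finset.sum_Ico_eq_sum_range]
    have h := Finset.sum_range_sub (fun i => g (j₀ + i)) (L - j₀)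
    simp only [Nat.add_sub_cancel' hj, hL, add_zero, zero_sub] at h
    -- `h : ∑ (g (j₀ + (i+1)) - g (j₀ + i)) = - g j₀`
    have h' : ∑ i ∈ Finset.range (L - j₀), (g (j₀ + i) - g (j₀ + i + 1)) = g j₀ := by
      have : ∑ i ∈ Finset.range (L - j₀), (g (j₀ + i) - g (j₀ + i + 1)) =
          -∑ i ∈ Finset.range (L - j₀), (g (j₀ + (i + 1)) - g (j₀ + i)) := by
        rw [← Finset.sum_neg_distrib]
        exact Finset.sum_congr rfl fun i _ => by rw [← add_assoc]; ring
      rw [this, h, neg_neg]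
    rw [← h']
    exact Finset.sum_le_sum fun i _ => by
      rw [abs_sub_comm]; exact le_abs_self _
  linarith

/-- Absorbing `√N` into `ε N^{2/3}`: if `(1/ε)^6 ≤ N` then `√N ≤ ε·N^{2/3}`. -/
theorem sqrt_le_eps_mul_rpow {ε N : ℝ} (hε : 0 < ε) (hN : (1 / ε) ^ 6 ≤ N) :
    Real.sqrt N ≤ ε * N ^ ((2 : ℝ) / 3) := by
  have hε6 : 0 < (1 / ε) ^ 6 := by positivity
  have hN0 : 0 < N := lt_of_lt_of_le hε6 hN
  have h1 : 1 / ε ≤ N ^ ((1 : ℝ) / 6) := by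
    have h := Real.rpow_le_rpow hε6.le hN (by norm_num : (0 : ℝ) ≤ (1 : ℝ) / 6)
    rw [show ((1 : ℝ) / 6) = ((6 : ℕ) : ℝ)⁻¹ by norm_num] at h ⊢
    rwa [Real.pow_rpow_inv_natCast (by positivity) (by norm_num)] at h
  have h2 : 1 ≤ ε * N ^ ((1 : ℝ) / 6) := by
    have := mul_le_mul_of_nonneg_left h1 hε.le
    rwa [mul_one_div_cancel hε.ne'] at this
  have h3 : N ^ ((2 : ℝ) / 3) = N ^ ((1 : ℝ) / 6) * N ^ ((1 : ℝ) / 2) := by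
    rw [← Real.rpow_add hN0]; norm_num
  rw [Real.sqrt_eq_rpow, h3, ← mul_assoc]
  have h4 : 0 ≤ N ^ ((1 : ℝ) / 2) := by positivity
  nlinarith

end Summit.Ventures.Crystal3D.Theorems

end
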